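import Literature.MathematicalPhysics.QuantumFieldTheory.MullerSchiemann1987.MS87Theorem2Part3
import Literature.MathematicalPhysics.QuantumFieldTheory.MullerSchiemann1987.MS87CentralAngleExpansion
import Literature.MathematicalPhysics.QuantumFieldTheory.MullerSchiemann1987.MS87Theorem3Continuation
import Literature.MathematicalPhysics.QuantumFieldTheory.MullerSchiemann1987.MS87ClassFunctionsSU2
import HarnessLib

/-!
# Müller–Schiemann, *Continuum limit of a hierarchical SU(2) lattice gauge theory in 4 dimensions*
# (CMP 110, 1987), THE WILSON ACTION (2.5) AS INITIAL GIBBS FACTOR: its analytic continuation (2.6)–(2.7),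
# (2.8)–(2.10), and the induction hypotheses (A₁), (A₃) (with Theorem 2's «W: λ = −β/3!, σ = β/5!») and the
# nonperturbative bound (A₂) — «easily seen to hold in the case of the Wilson action» (p.268 L.30–31) — PROVED,
# with Theorem 2 part 3) at the initial scale as a corollary (theorems only; no definition, no named fact)

statement-level skeleton of published theorems with citation tags; proofs where landed; nothing here is a claim about the Yang–Mills mass gap

**Citation header (reproduction of PUBLISHED work).** V. F. Müller, J. Schiemann, *Continuum limit of a hierarchical
SU(2) lattice gauge theory in 4 dimensions*, Commun. Math. Phys. **110** (1987) 261–286, doi 10.1007/BF01207367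
[MullerSchiemann1987]; (2.1)–(2.3) p.263, (2.5)–(2.12) p.264, (2.13)–(2.18) pp.264–265, (3.5) and (A₁) p.266,
(A₂)–(A₃) p.267, p.268 L.28–31, Theorem 2 part 3) and its proof p.281 (held Project Euclid scan
`paper:url-96df5da18d4c`; displays read by this seat on its own 3× page renders `run/shared/lean/pub/lit-balaban/
lit-balaban-p12/renders-cmp110ms/ms87-cmp110-pdfp004,005,006,007,008,021-journalp264–268,281-x3.png`). Lean lane of
the lit-balaban YM LIT SWEEP CONTEXT row X1 (register level; zero weight for any token of that table); the model is
the `d = 4` HIERARCHICAL `SU(2)` gauge model, NOT lattice Yang–Mills.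

**What the paper prints.** (2.5) p.264: *«Starting with the Wilson action, β ∈ ℝ₊, g^{(0)}(u) = exp{β(trace u − 2)},
(2.5) we proved inductively in (I): (Proposition 1), that the functions g̃^{(n)}(u, x) := g^{(n)}(e^{−ixσ₃}u), n ∈ ℕ₀
(2.6) can be analytically continued … (2.7) and the functions g̃^{(n)}(u, z) are (i) continuous in u for fixed z ∈ ℂ,
(ii) entire and real analytic in z ∈ ℂ for fixed u ∈ G.»*; (2.8) `g̃(e^{−ix′σ₃}u, z) = g̃(u, x′ + z)`, (2.9)
`g̃(u, z) = g̃(u⁻¹, −z)`, (2.10) `h(z) := g̃(e₀, z)`, (2.11)–(2.12); (A₁) p.266: *«g̃(u, z) is continuous in u ∈ G for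
fixed z ∈ ℂ and entire holomorphic in z for fixed u. Moreover g(u) = g̃(u, 0) is real and positive, satisfying
(2.1)–(2.3).»*; (A₂) p.267: *«For y ∈ ℝ, |y| < (κ/2)β^{−α} and u ∈ G∖𝒢[iy, β^{−α}], |g̃(u, iy)| < exp{βy² − pβ^{1−2α}},
with 1 < κ < 1 + ε (ε > 0 small) and ½ < p < 1 − κ²/4.»*; (A₃) p.267: *«In the domain z ∈ ℂ, |z| < β^{−α}, there
exists a holomorphic function V(z) such that h(z) = exp{−V(z)}, V(z) = βz² + ½λz⁴ + ⅓σz⁶ + Ṽ(z), Ṽ(z) = 𝒪(z⁸).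
β ∈ ℝ₊ is large and |β⁻¹λ|, |β⁻¹σ| are bounded by constants. Moreover the bound |Ṽ(z)| < Dβ⁻² holds in the domain,
with a constant D.»*; (3.5) p.266: *«|z| < β^{−α}, with 3/7 ≤ α < ½ (fixed)»*; p.268 L.28–31: *«The initial
(analytically continued) Gibbs factor g̃^{(0)}(u, z) both with Wilson action (2.5) and with heat kernel action (2.20)
satisfies (A₁) as shown in (I) and in Sect. 2, respectively. The properties (A₂) and (A₃), stated for the weak
coupling region β ≥ β̲ with large β̲, are easily seen to hold in the case of the Wilson action.»*; proof of Theorem 2,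
p.281 L.17: *«For the Wilson action (W) and the heat kernel action (HK) we have W: λ_N^{(−N)} = −(1/3!)β_N^{(−N)},
σ_N^{(−N)} = (1/5!)β_N^{(−N)} …»*; (2.18) p.265: *«𝒢[z, ϱ] := {u ∈ G : u₀ > 0 and |θ²(u, z)| < ϱ²}»*.

**What this file proves (kernel-checked, 0 sorry, standard axioms; no definition, no named fact).** `u₀, u₃,
e^{−ixσ₃}` are `HeatKernel.u0/u3/diagPhase`; `𝒢` of p.283 is `Migdal.InG`; `θ²`, `η` are `CentralAngle.thetaSq/etaOf`
and `𝒢[z, ϱ]` is `Theorem2Part3.regionG`. The Wilson Gibbs factor is written `g_W(u) = exp{2β(u₀ − 1)}` (= (2.5) by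
`trace u = 2u₀`) and its continuation `g̃_W(u, z) = exp{2β(u₀ cos z + u₃ sin z − 1)}` — the form (6.21)
`H(u₀ cos z + u₃ sin z)` with the entire `H(w) = exp{2β(w − 1)}`.
* §1 (2.5) = `exp{2β(u₀ − 1)}` (`eq25`); **(2.6)**: `g̃_W(u, x) = g_W(e^{−ixσ₃}u)` for real `x` (`gtW_ofReal`, by (2.17)
  `u₀(e^{−ixσ₃}u) = u₀ cos x + u₃ sin x`); `g̃_W(u, 0) = g_W(u)`.
* §2 **(A₁) FOR THE WILSON ACTION**: `g̃_W(u, ·)` entire, `g̃_W(·, z)` continuous, jointly continuous, real for real `z`;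
  `g_W > 0`, (2.1) `g_W(e₀) = 1`, (2.2) class function (the trace is), (2.3) `g_W(u⁻¹) = g_W(u)`; `g_W ∈ 𝒢`
  (`inG_gW`); assembled as `A1_wilson` in the format of the sibling's `A1_heatKernel`. **(2.8)–(2.10)** for `g̃_W`
  (`gtW_diagPhase_mul`, `gtW_inv_neg`, `gtW_one`), (2.11)–(2.12) for `h_W(z) = exp{2β(cos z − 1)}`.
* §3 **(A₃) FOR THE WILSON ACTION**: `h_W = exp{−V_W}` with the ENTIRE `V_W(z) = 2β(1 − cos z)`; the Taylor split
  `V_W(z) = βz² + ½λ_W z⁴ + ⅓σ_W z⁶ + Ṽ_W(z)` with **`λ_W = −β/3!`, `σ_W = β/5!`** (Theorem 2's «W:» line) and the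
  EXPLICIT remainder bound `|Ṽ_W(z)| ≤ (9/161280)·β|z|⁸` for `|z| ≤ 1` (`norm_VtildeW_le`, from Mathlib's
  `Complex.exp_bound` at order 8: `cos_taylor6_bound`), hence `Ṽ_W = 𝒪(z⁸)` and, in the small-field domain
  `|z| < β^{−α}` with `β ≥ 1`, `α ≥ 3/8` (so for the paper's `3/7 ≤ α < ½`), **`|Ṽ_W(z)| ≤ (9/161280)β⁻²`**
  (`A3_wilson_remainder`: `β^{1−8α} ≤ β⁻²`); `|β⁻¹λ_W| = 1/6`, `|β⁻¹σ_W| = 1/120`.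
* §4 **(A₂) FOR THE WILSON ACTION, QUANTITATIVE**: `|g̃_W(u, iy)| = exp{2β(u₀ cosh y − 1)}` (`norm_gtW_mul_I`); the
  modulus of `η(u, iy) = ½(1 − u₀ cosh y − iu₃ sinh y)` is at most `½[(1 − u₀) + (cosh y − 1)]` (`norm_etaOf_mul_I_le`,
  from `u₀² + u₃² ≤ 1` and `cosh² − sinh² = 1`), so `|θ²(u, iy)| ≤ 2s(1 + s)` with `s = (1 − u₀) + (cosh y − 1) ≤ 1`
  (`norm_thetaSq_mul_I_le`, the sibling's `|θ² − 4η| ≤ 8|η|²`); hence the β-FREE core (`A2_core`): for `1 < κ`,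
  `0 ≤ p < 1 − κ²/4`, `0 < ϱ ≤ ϱ₀ := min(1/2, (1 − κ²/4 − p)/3)`, `|y| < (κ/2)ϱ` and `u ∉ 𝒢[iy, ϱ]`:
  `2(u₀ cosh y − 1) < y² − pϱ²`; multiplying by `β > 0`: **`|g̃_W(u, iy)| < exp{βy² − pβϱ²}`** (`A2_wilson_rho`), and
  with `ϱ = β^{−α}`, i.e. for every `β > 0` with `β^{−α} ≤ ϱ₀` («β ≥ β̲»): **(A₂) as printed** (`A2_wilson`).
* §5 **THEOREM 2 PART 3) FOR THE WILSON ACTION AT THE INITIAL SCALE** (`thm2_part3_wilson`): the sibling's model-free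
  `Theorem2Part3.thm2_part3` with (2.8) and (A₂) DISCHARGED for `g̃_W`: `|h_W(x + iy)| < exp{βy² − pβ^{1−2α}}` for
  `β^{−α} ≤ |x + iy| < 1`, `|y| < (κ/2)β^{−α}`, whenever `β^{−α} ≤ ϱ₀`.

**Readings / scope (declared).** (i) (A₂) is proved for every `β > 0` once `β^{−α} ≤ ϱ₀(κ, p)` — the paper's «weak
coupling region β ≥ β̲» with the explicit `β̲ = ϱ₀^{−1/α}`; we use `0 ≤ p` (the paper has `½ < p`) and do not need
`κ < 1 + ε`. (ii) In (A₃) the paper's `D` is any constant; we give `D = 9/161280` (times `β^{1−8α} ≤ β⁻²`, which is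
where `α ≥ 3/8` — implied by (3.5)'s `3/7 ≤ α` — and `β ≥ 1` enter). (iii) «is proven in (I)» for general `n` is the
induction of Theorem 1 and is not touched; this file is the base case `n = 0` for (W), the sibling
`MS87HeatKernelGroup.A1_heatKernel` being the (A₁) base case for (HK).

**Not claimed.** Theorem 1; (A₂)/(A₃) for the heat-kernel action (Appendix); anything about lattice Yang–Mills or the
Clay problem.
-/

noncomputable section

open Complex Set Filter
open scoped Real Topology

namespace Literature.MathematicalPhysics.QuantumFieldTheory

namespace MullerSchiemann1987

namespace WilsonAction

open HeatKernel (u0 u3 diagPhase diagPhase_zero u0_diagPhase_mul u3_diagPhase_mul u0_one u3_one u0_inv u3_inv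
  trace_val_eq trace_conj continuous_u0 continuous_u3 u0_sq_add_u3_sq_le_one abs_u0_le_one)
open Migdal (InG IsCentral IsSymm)
open CentralAngle (etaOf thetaSq)
open ThetaSqExpansion (norm_thetaSq_sub_le etaOf_mul_I_re etaOf_mul_I_im)
open Theorem2Part3 (regionG mem_regionG thm2_part3)
open Theorem3Continuation (eq621_symm28 eq621_symm29)
open ClassFunctionsSU2 (u0_conj)

/-! ## §1 The Wilson action (2.5) and its analytic continuation (2.6)–(2.7) -/

/-- **(2.5)**: `g^{(0)}(u) = exp{β(trace u − 2)} = exp{2β(u₀ − 1)}` on `SU(2)` (`trace u = 2u₀`).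
[cite: MullerSchiemann1987, (2.5) p.264] -/
theorem eq25 (β : ℝ) (U : Matrix.specialUnitaryGroup (Fin 2) ℂ) :
    Complex.exp ((β : ℂ) * (Matrix.trace (U : Matrix (Fin 2) (Fin 2) ℂ) - 2)) =
      ((Real.exp (2 * β * (u0 U - 1)) : ℝ) : ℂ) := by
  rw [trace_val_eq, Complex.ofReal_exp]
  push_cast
  ring_nf

/-- **(2.6)**: for REAL `x`, the continuation `g̃_W(u, z) = exp{2β(u₀ cos z + u₃ sin z − 1)}` restricts to the
translated Wilson factor `g_W(e^{−ixσ₃}u)` ((2.17): `u₀(e^{−ixσ₃}u) = u₀ cos x + u₃ sin x`).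
[cite: MullerSchiemann1987, (2.6) p.264, (2.17) p.265] -/
theorem gtW_ofReal (β : ℝ) (U : Matrix.specialUnitaryGroup (Fin 2) ℂ) (x : ℝ) :
    Complex.exp (2 * (β : ℂ) * ((u0 U : ℂ) * Complex.cos (x : ℂ) + (u3 U : ℂ) * Complex.sin (x : ℂ) - 1)) =
      ((Real.exp (2 * β * (u0 (diagPhase x * U) - 1)) : ℝ) : ℂ) := by
  rw [u0_diagPhase_mul, Complex.ofReal_exp, ← Complex.ofReal_cos, ← Complex.ofReal_sin]
  push_cast
  ring_nf

/-- `g̃_W(u, 0) = g_W(u)` («g(u) = g̃(u, 0)» of (A₁)). [cite: MullerSchiemann1987, (A₁) p.266, (2.6) p.264] -/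
theorem gtW_zero (β : ℝ) (U : Matrix.specialUnitaryGroup (Fin 2) ℂ) :
    Complex.exp (2 * (β : ℂ) * ((u0 U : ℂ) * Complex.cos 0 + (u3 U : ℂ) * Complex.sin 0 - 1)) =
      ((Real.exp (2 * β * (u0 U - 1)) : ℝ) : ℂ) := by
  have h := gtW_ofReal β U 0
  rwa [Complex.ofReal_zero, diagPhase_zero, one_mul] at h

/-! ## §2 (A₁) and (2.8)–(2.12) for the Wilson action -/

/-- The argument `z ↦ u₀ cos z + u₃ sin z` is entire. [folklore] -/
private theorem differentiable_arg (U : Matrix.specialUnitaryGroup (Fin 2) ℂ) :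
    Differentiable ℂ fun z : ℂ => (u0 U : ℂ) * Complex.cos z + (u3 U : ℂ) * Complex.sin z :=
  ((differentiable_const _).mul Complex.differentiable_cos).add
    ((differentiable_const _).mul Complex.differentiable_sin)

/-- **(A₁)/(2.7)(ii) for (W)**: `z ↦ g̃_W(u, z)` is ENTIRE for every `u`. [cite: MullerSchiemann1987, (2.7) p.264,
(A₁) p.266, p.268 L.28–30] -/
theorem differentiable_gtW (β : ℝ) (U : Matrix.specialUnitaryGroup (Fin 2) ℂ) :
    Differentiable ℂ fun z : ℂ =>
      Complex.exp (2 * (β : ℂ) * ((u0 U : ℂ) * Complex.cos z + (u3 U : ℂ) * Complex.sin z - 1)) :=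
  (((differentiable_const _).mul ((differentiable_arg U).sub (differentiable_const _)))).cexp

/-- **(A₁)/(2.7)(i) for (W)**: `u ↦ g̃_W(u, z)` is continuous on `SU(2)` for every `z`. [cite: MullerSchiemann1987,
(2.7) p.264, (A₁) p.266] -/
theorem continuous_gtW_left (β : ℝ) (z : ℂ) :
    Continuous fun U : Matrix.specialUnitaryGroup (Fin 2) ℂ =>
      Complex.exp (2 * (β : ℂ) * ((u0 U : ℂ) * Complex.cos z + (u3 U : ℂ) * Complex.sin z - 1)) := by
  refine Complex.continuous_exp.comp (continuous_const.mul (Continuous.sub ?_ continuous_const))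
  exact ((Complex.continuous_ofReal.comp continuous_u0).mul continuous_const).add
    ((Complex.continuous_ofReal.comp continuous_u3).mul continuous_const)

/-- Joint continuity of `g̃_W` in `(u, z)`. [cite: MullerSchiemann1987, (A₁) p.266] -/
theorem continuous_gtW (β : ℝ) :
    Continuous fun p : Matrix.specialUnitaryGroup (Fin 2) ℂ × ℂ =>
      Complex.exp (2 * (β : ℂ) * ((u0 p.1 : ℂ) * Complex.cos p.2 + (u3 p.1 : ℂ) * Complex.sin p.2 - 1)) := by
  refine Complex.continuous_exp.comp (continuous_const.mul (Continuous.sub ?_ continuous_const))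
  exact ((Complex.continuous_ofReal.comp (continuous_u0.comp continuous_fst)).mul
      (Complex.continuous_cos.comp continuous_snd)).add
    ((Complex.continuous_ofReal.comp (continuous_u3.comp continuous_fst)).mul
      (Complex.continuous_sin.comp continuous_snd))

/-- **(2.7)(ii) «real analytic» for (W)**: `g̃_W(u, x)` is real for real `x`. [cite: MullerSchiemann1987, (2.7) p.264] -/
theorem gtW_im_ofReal (β : ℝ) (U : Matrix.specialUnitaryGroup (Fin 2) ℂ) (x : ℝ) :
    (Complex.exp (2 * (β : ℂ) * ((u0 U : ℂ) * Complex.cos (x : ℂ) + (u3 U : ℂ) * Complex.sin (x : ℂ) - 1))).im = 0 := by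
  rw [gtW_ofReal, Complex.ofReal_im]

/-- **(A₁) for (W): `g_W` is positive.** [cite: MullerSchiemann1987, (A₁) p.266, p.263 L.32] -/
theorem gW_pos (β : ℝ) (U : Matrix.specialUnitaryGroup (Fin 2) ℂ) : 0 < Real.exp (2 * β * (u0 U - 1)) :=
  Real.exp_pos _

/-- **(2.1) for (W)**: `g_W(e₀) = 1` (`u₀(e₀) = 1`). [cite: MullerSchiemann1987, (2.1) p.263, (2.5) p.264] -/
theorem gW_one (β : ℝ) : Real.exp (2 * β * (u0 (1 : Matrix.specialUnitaryGroup (Fin 2) ℂ) - 1)) = 1 := by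
  rw [u0_one, sub_self, mul_zero, Real.exp_zero]

/-- **(2.2) for (W)**: `g_W(vuv⁻¹) = g_W(u)`. [cite: MullerSchiemann1987, (2.2) p.263, (2.5) p.264] -/
theorem gW_conj (β : ℝ) (U V : Matrix.specialUnitaryGroup (Fin 2) ℂ) :
    Real.exp (2 * β * (u0 (V * U * V⁻¹) - 1)) = Real.exp (2 * β * (u0 U - 1)) := by
  rw [u0_conj]

/-- **(2.3) for (W)**: `g_W(u⁻¹) = g_W(u)`. [cite: MullerSchiemann1987, (2.3) p.263, (2.5) p.264] -/
theorem gW_inv (β : ℝ) (U : Matrix.specialUnitaryGroup (Fin 2) ℂ) :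
    Real.exp (2 * β * (u0 U⁻¹ - 1)) = Real.exp (2 * β * (u0 U - 1)) := by
  rw [u0_inv]

/-- **`g_W ∈ 𝒢`** (continuous class function, `≥ 0`, `= 1` at `e₀`) and symmetric — the membership used by the
iteration of p.283. [cite: MullerSchiemann1987, (2.1)–(2.3) p.263, p.283 L.27–28] -/
theorem inG_gW (β : ℝ) : InG (fun U : Matrix.specialUnitaryGroup (Fin 2) ℂ => Real.exp (2 * β * (u0 U - 1))) where
  continuous := Real.continuous_exp.comp (continuous_const.mul (continuous_u0.sub continuous_const))
  central := fun U V => gW_conj β U V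
  nonneg := fun U => (gW_pos β U).le
  apply_one := gW_one β

/-- `g_W` is symmetric ((2.3)). [cite: MullerSchiemann1987, (2.3) p.263] -/
theorem isSymm_gW (β : ℝ) : IsSymm (fun U : Matrix.specialUnitaryGroup (Fin 2) ℂ => Real.exp (2 * β * (u0 U - 1))) :=
  fun U => gW_inv β U

/-- **(2.8) for (W)**: `g̃_W(e^{−ix′σ₃}u, z) = g̃_W(u, x′ + z)`. [cite: MullerSchiemann1987, (2.8) p.264] -/
theorem gtW_diagPhase_mul (β : ℝ) (x' : ℝ) (U : Matrix.specialUnitaryGroup (Fin 2) ℂ) (z : ℂ) :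
    Complex.exp (2 * (β : ℂ) * ((u0 (diagPhase x' * U) : ℂ) * Complex.cos z + (u3 (diagPhase x' * U) : ℂ) * Complex.sin z - 1)) =
      Complex.exp (2 * (β : ℂ) * ((u0 U : ℂ) * Complex.cos ((x' : ℂ) + z) + (u3 U : ℂ) * Complex.sin ((x' : ℂ) + z) - 1)) :=
  eq621_symm28 (fun w : ℂ => Complex.exp (2 * (β : ℂ) * (w - 1))) x' U z

/-- **(2.9) for (W)**: `g̃_W(u⁻¹, −z) = g̃_W(u, z)`. [cite: MullerSchiemann1987, (2.9) p.264] -/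
theorem gtW_inv_neg (β : ℝ) (U : Matrix.specialUnitaryGroup (Fin 2) ℂ) (z : ℂ) :
    Complex.exp (2 * (β : ℂ) * ((u0 U⁻¹ : ℂ) * Complex.cos (-z) + (u3 U⁻¹ : ℂ) * Complex.sin (-z) - 1)) =
      Complex.exp (2 * (β : ℂ) * ((u0 U : ℂ) * Complex.cos z + (u3 U : ℂ) * Complex.sin z - 1)) :=
  eq621_symm29 (fun w : ℂ => Complex.exp (2 * (β : ℂ) * (w - 1))) U z

/-- **(2.10) for (W)**: `h_W(z) := g̃_W(e₀, z) = exp{2β(cos z − 1)}`. [cite: MullerSchiemann1987, (2.10) p.264] -/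
theorem gtW_one (β : ℝ) (z : ℂ) :
    Complex.exp (2 * (β : ℂ) * ((u0 (1 : Matrix.specialUnitaryGroup (Fin 2) ℂ) : ℂ) * Complex.cos z +
        (u3 (1 : Matrix.specialUnitaryGroup (Fin 2) ℂ) : ℂ) * Complex.sin z - 1)) =
      Complex.exp (2 * (β : ℂ) * (Complex.cos z - 1)) := by
  rw [u0_one, u3_one]
  push_cast
  ring_nf

/-- **(2.11) for (W)**: `h_W(z + π) = h_W(z − π)`. [cite: MullerSchiemann1987, (2.11) p.264] -/
theorem hW_add_pi_eq_sub_pi (β : ℝ) (z : ℂ) :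
    Complex.exp (2 * (β : ℂ) * (Complex.cos (z + π) - 1)) = Complex.exp (2 * (β : ℂ) * (Complex.cos (z - π) - 1)) := by
  rw [Complex.cos_add_pi, Complex.cos_sub_pi]

/-- **(2.12) for (W)**: `h_W(z) = h_W(−z)`. [cite: MullerSchiemann1987, (2.12) p.264] -/
theorem hW_even (β : ℝ) (z : ℂ) :
    Complex.exp (2 * (β : ℂ) * (Complex.cos z - 1)) = Complex.exp (2 * (β : ℂ) * (Complex.cos (-z) - 1)) := by
  rw [Complex.cos_neg]

/-- **HYPOTHESIS (A₁) OF SECT. 3 HOLDS FOR THE WILSON ACTION** (base case `n = 0` for the initial Gibbs factor (2.5)),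
in the format of the sibling's `HeatKernel.A1_heatKernel`: continuity in `u`, entire in `z`, `g_W = g̃_W(·, 0)` real
and positive with (2.1)–(2.3). [cite: MullerSchiemann1987, (A₁) p.266, p.268 L.28–30] -/
theorem A1_wilson (β : ℝ) :
    (∀ z : ℂ, Continuous fun U : Matrix.specialUnitaryGroup (Fin 2) ℂ =>
      Complex.exp (2 * (β : ℂ) * ((u0 U : ℂ) * Complex.cos z + (u3 U : ℂ) * Complex.sin z - 1))) ∧
    (∀ U : Matrix.specialUnitaryGroup (Fin 2) ℂ, Differentiable ℂ fun z : ℂ =>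
      Complex.exp (2 * (β : ℂ) * ((u0 U : ℂ) * Complex.cos z + (u3 U : ℂ) * Complex.sin z - 1))) ∧
    (∀ U : Matrix.specialUnitaryGroup (Fin 2) ℂ,
      Complex.exp (2 * (β : ℂ) * ((u0 U : ℂ) * Complex.cos 0 + (u3 U : ℂ) * Complex.sin 0 - 1)) =
        ((Real.exp (2 * β * (u0 U - 1)) : ℝ) : ℂ)) ∧
    (∀ U : Matrix.specialUnitaryGroup (Fin 2) ℂ, 0 < Real.exp (2 * β * (u0 U - 1))) ∧
    Real.exp (2 * β * (u0 (1 : Matrix.specialUnitaryGroup (Fin 2) ℂ) - 1)) = 1 ∧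
    (∀ U V : Matrix.specialUnitaryGroup (Fin 2) ℂ,
      Real.exp (2 * β * (u0 (V * U * V⁻¹) - 1)) = Real.exp (2 * β * (u0 U - 1))) ∧
    (∀ U : Matrix.specialUnitaryGroup (Fin 2) ℂ, Real.exp (2 * β * (u0 U⁻¹ - 1)) = Real.exp (2 * β * (u0 U - 1))) :=
  ⟨continuous_gtW_left β, differentiable_gtW β, gtW_zero β, gW_pos β, gW_one β, gW_conj β, gW_inv β⟩

/-! ## §3 (A₃) for the Wilson action: `h_W = exp{−V_W}`, `V_W(z) = 2β(1 − cos z) = βz² + ½λ_W z⁴ + ⅓σ_W z⁶ + Ṽ_W(z)`,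
`λ_W = −β/3!`, `σ_W = β/5!`, `|Ṽ_W(z)| ≤ (9/161280)β|z|⁸` -/

/-- `h_W(z) = exp{−V_W(z)}` with `V_W(z) = 2β(1 − cos z)`. [cite: MullerSchiemann1987, (A₃) p.267, (2.5) p.264] -/
theorem hW_eq_exp_neg_VW (β : ℝ) (z : ℂ) :
    Complex.exp (2 * (β : ℂ) * (Complex.cos z - 1)) = Complex.exp (-(2 * (β : ℂ) * (1 - Complex.cos z))) := by
  congr 1; ring

/-- `V_W(z) = 2β(1 − cos z)` is entire («there exists a holomorphic function V(z)»). [cite: MullerSchiemann1987, (A₃)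
p.267] -/
theorem differentiable_VW (β : ℝ) : Differentiable ℂ fun z : ℂ => 2 * (β : ℂ) * (1 - Complex.cos z) :=
  (differentiable_const _).mul ((differentiable_const _).sub Complex.differentiable_cos)

/-- The sixth-order Taylor bound for the complex cosine: `|cos z − (1 − z²/2 + z⁴/24 − z⁶/720)| ≤ (9/322560)|z|⁸` for
`|z| ≤ 1` (Mathlib's `Complex.exp_bound` at order 8 on `e^{±iz}`, as in Mathlib's `Complex.cos_bound`). [folklore] -/
private theorem cos_taylor6_bound {x : ℂ} (hx : ‖x‖ ≤ 1) :
    ‖Complex.cos x - (1 - x ^ 2 / 2 + x ^ 4 / 24 - x ^ 6 / 720)‖ ≤ ‖x‖ ^ 8 * (9 / 322560) := by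
  have hS : ∀ w : ℂ, ∑ m ∈ Finset.range 8, w ^ m / (m.factorial : ℂ) =
      1 + w + w ^ 2 / 2 + w ^ 3 / 6 + w ^ 4 / 24 + w ^ 5 / 120 + w ^ 6 / 720 + w ^ 7 / 5040 := by
    intro w
    simp only [Finset.sum_range_succ, Finset.sum_range_zero, Nat.factorial]
    push_cast
    ring
  have hI2 : Complex.I ^ 2 = -1 := Complex.I_sq
  have hid : Complex.cos x - (1 - x ^ 2 / 2 + x ^ 4 / 24 - x ^ 6 / 720) =
      (Complex.exp (-x * I) - ∑ m ∈ Finset.range 8, (-x * I) ^ m / (m.factorial : ℂ)) / 2 +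
        (Complex.exp (x * I) - ∑ m ∈ Finset.range 8, (x * I) ^ m / (m.factorial : ℂ)) / 2 := by
    rw [hS, hS, Complex.cos]
    linear_combination ((x ^ 2 + x ^ 4 * (Complex.I ^ 2 - 1) / 12 + x ^ 6 * (Complex.I ^ 4 - Complex.I ^ 2 + 1) / 360) / 2) * hI2
  rw [hid]
  have h1 := Complex.exp_bound (x := -x * I) (by simpa using hx) (show 0 < 8 by norm_num)
  have h2 := Complex.exp_bound (x := x * I) (by simpa using hx) (show 0 < 8 by norm_num)
  have hn1 : ‖-x * I‖ = ‖x‖ := by simp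
  have hn2 : ‖x * I‖ = ‖x‖ := by simp
  rw [hn1] at h1
  rw [hn2] at h2
  have hc : ((Nat.succ 8 : ℕ) : ℝ) * (((Nat.factorial 8 : ℕ) : ℝ) * ((8 : ℕ) : ℝ))⁻¹ = 9 / 322560 := by
    norm_num [Nat.factorial]
  rw [hc] at h1 h2
  calc ‖(Complex.exp (-x * I) - ∑ m ∈ Finset.range 8, (-x * I) ^ m / (m.factorial : ℂ)) / 2 +
        (Complex.exp (x * I) - ∑ m ∈ Finset.range 8, (x * I) ^ m / (m.factorial : ℂ)) / 2‖
      ≤ ‖(Complex.exp (-x * I) - ∑ m ∈ Finset.range 8, (-x * I) ^ m / (m.factorial : ℂ)) / 2‖ +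
        ‖(Complex.exp (x * I) - ∑ m ∈ Finset.range 8, (x * I) ^ m / (m.factorial : ℂ)) / 2‖ := norm_add_le _ _
    _ = ‖Complex.exp (-x * I) - ∑ m ∈ Finset.range 8, (-x * I) ^ m / (m.factorial : ℂ)‖ / 2 +
        ‖Complex.exp (x * I) - ∑ m ∈ Finset.range 8, (x * I) ^ m / (m.factorial : ℂ)‖ / 2 := by
          rw [norm_div, norm_div, Complex.norm_two]
    _ ≤ ‖x‖ ^ 8 * (9 / 322560) / 2 + ‖x‖ ^ 8 * (9 / 322560) / 2 := by gcongr
    _ = ‖x‖ ^ 8 * (9 / 322560) := by ring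

/-- **(A₃) for (W), the Taylor split with Theorem 2's «W: λ = −β/3!, σ = β/5!»**: `V_W(z) = βz² + ½λ_W z⁴ + ⅓σ_W z⁶ +
Ṽ_W(z)` where the remainder `Ṽ_W(z) := V_W(z) − (βz² + ½λ_W z⁴ + ⅓σ_W z⁶)` equals `−2β[cos z − (1 − z²/2 + z⁴/24 −
z⁶/720)]`. [cite: MullerSchiemann1987, (A₃) p.267, Thm 2 proof p.281 L.17] -/
theorem VtildeW_eq (β : ℝ) (z : ℂ) :
    2 * (β : ℂ) * (1 - Complex.cos z) -
        ((β : ℂ) * z ^ 2 + (1 / 2) * (-(β : ℂ) / Nat.factorial 3) * z ^ 4 + (1 / 3) * ((β : ℂ) / Nat.factorial 5) * z ^ 6) =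
      -(2 * (β : ℂ)) * (Complex.cos z - (1 - z ^ 2 / 2 + z ^ 4 / 24 - z ^ 6 / 720)) := by
  simp only [Nat.factorial]
  push_cast
  ring

/-- **(A₃) for (W), the remainder bound**: `|Ṽ_W(z)| ≤ (9/161280)·β·|z|⁸` for `|z| ≤ 1`, `β ≥ 0` — so `Ṽ_W(z) = 𝒪(z⁸)`.
[cite: MullerSchiemann1987, (A₃) p.267 («Ṽ(z) = 𝒪(z⁸)»)] -/
theorem norm_VtildeW_le {β : ℝ} (hβ : 0 ≤ β) {z : ℂ} (hz : ‖z‖ ≤ 1) :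
    ‖2 * (β : ℂ) * (1 - Complex.cos z) -
        ((β : ℂ) * z ^ 2 + (1 / 2) * (-(β : ℂ) / Nat.factorial 3) * z ^ 4 + (1 / 3) * ((β : ℂ) / Nat.factorial 5) * z ^ 6)‖ ≤
      9 / 161280 * β * ‖z‖ ^ 8 := by
  rw [VtildeW_eq, norm_mul, norm_neg, norm_mul, Complex.norm_two, Complex.norm_real, Real.norm_of_nonneg hβ]
  have h := cos_taylor6_bound hz
  have : 2 * β * ‖Complex.cos z - (1 - z ^ 2 / 2 + z ^ 4 / 24 - z ^ 6 / 720)‖ ≤ 2 * β * (‖z‖ ^ 8 * (9 / 322560)) :=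
    mul_le_mul_of_nonneg_left h (by positivity)
  linarith

/-- `Ṽ_W(z) = 𝒪(z⁸)` as `z → 0`. [cite: MullerSchiemann1987, (A₃) p.267] -/
theorem VtildeW_isBigO (β : ℝ) (hβ : 0 ≤ β) :
    (fun z : ℂ => 2 * (β : ℂ) * (1 - Complex.cos z) -
        ((β : ℂ) * z ^ 2 + (1 / 2) * (-(β : ℂ) / Nat.factorial 3) * z ^ 4 + (1 / 3) * ((β : ℂ) / Nat.factorial 5) * z ^ 6))
      =O[𝓝 0] fun z : ℂ => z ^ 8 := by
  refine Asymptotics.IsBigO.of_bound (9 / 161280 * β) ?_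
  have hball : Metric.closedBall (0 : ℂ) 1 ∈ 𝓝 (0 : ℂ) := Metric.closedBall_mem_nhds 0 one_pos
  filter_upwards [hball] with z hz
  rw [Metric.mem_closedBall, dist_zero_right] at hz
  rw [norm_pow]
  exact norm_VtildeW_le hβ hz

/-- `|β⁻¹λ_W| = 1/3!` and `|β⁻¹σ_W| = 1/5!` — «|β⁻¹λ|, |β⁻¹σ| are bounded by constants». [cite: MullerSchiemann1987,
(A₃) p.267, Thm 2 proof p.281 L.17] -/
theorem couplingsW_ratio {β : ℝ} (hβ : β ≠ 0) :
    |β⁻¹ * (-β / Nat.factorial 3)| = 1 / 6 ∧ |β⁻¹ * (β / Nat.factorial 5)| = 1 / 120 := by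
  simp only [Nat.factorial]
  push_cast
  constructor
  · rw [show β⁻¹ * (-β / 6) = -(β⁻¹ * β) / 6 by ring, inv_mul_cancel₀ hβ]
    norm_num
  · rw [show β⁻¹ * (β / 120) = (β⁻¹ * β) / 120 by ring, inv_mul_cancel₀ hβ]
    norm_num

/-- `β^{1−8α} ≤ β⁻²` for `β ≥ 1` and `α ≥ 3/8` (the exponent bookkeeping of (A₃) for (W) under (3.5)). [folklore] -/
private theorem rpow_one_sub_eight_mul_le {β α : ℝ} (hβ : 1 ≤ β) (hα : 3 / 8 ≤ α) :
    β * (β ^ (-α)) ^ 8 ≤ β ^ (-2 : ℝ) := by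
  have hβ0 : 0 < β := by linarith
  have h1 : β * (β ^ (-α)) ^ 8 = β ^ (1 - 8 * α) := by
    rw [← Real.rpow_natCast, ← Real.rpow_mul hβ0.le, show (1 - 8 * α) = 1 + (-α * (8 : ℕ)) by push_cast; ring,
      Real.rpow_add hβ0, Real.rpow_one]
  rw [h1]
  exact Real.rpow_le_rpow_of_exponent_le hβ (by linarith)

/-- **(A₃) FOR THE WILSON ACTION IN THE SMALL-FIELD DOMAIN**: for `β ≥ 1`, `α ≥ 3/8` (the paper's (3.5): `3/7 ≤ α < ½`)
and `|z| < β^{−α}`: `|Ṽ_W(z)| ≤ (9/161280)β⁻²` — «the bound |Ṽ(z)| < Dβ⁻² holds in the domain, with a constant D».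
[cite: MullerSchiemann1987, (A₃) p.267, (3.5) p.266, p.268 L.30–31] -/
theorem A3_wilson_remainder {β α : ℝ} (hβ : 1 ≤ β) (hα : 3 / 8 ≤ α) {z : ℂ} (hz : ‖z‖ < β ^ (-α)) :
    ‖2 * (β : ℂ) * (1 - Complex.cos z) -
        ((β : ℂ) * z ^ 2 + (1 / 2) * (-(β : ℂ) / Nat.factorial 3) * z ^ 4 + (1 / 3) * ((β : ℂ) / Nat.factorial 5) * z ^ 6)‖ ≤
      9 / 161280 * β ^ (-2 : ℝ) := by
  have hβ0 : 0 < β := by linarith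
  have hρ1 : β ^ (-α) ≤ 1 := Real.rpow_le_one_of_one_le_of_nonpos hβ (by linarith)
  have hz1 : ‖z‖ ≤ 1 := (hz.le).trans hρ1
  have h1 := norm_VtildeW_le hβ0.le hz1
  have h2 : ‖z‖ ^ 8 ≤ (β ^ (-α)) ^ 8 := pow_le_pow_left₀ (norm_nonneg _) hz.le 8
  have h3 := rpow_one_sub_eight_mul_le hβ hα
  calc _ ≤ 9 / 161280 * β * ‖z‖ ^ 8 := h1
    _ ≤ 9 / 161280 * β * (β ^ (-α)) ^ 8 := by gcongr
    _ = 9 / 161280 * (β * (β ^ (-α)) ^ 8) := by ring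
    _ ≤ 9 / 161280 * β ^ (-2 : ℝ) := by gcongr

/-! ## §4 (A₂) for the Wilson action -/

/-- **`|g̃_W(u, iy)| = exp{2β(u₀ cosh y − 1)}`** (`cos(iy) = cosh y`, `sin(iy) = i sinh y`). [cite: MullerSchiemann1987,
(A₂) p.267, (3.6) p.267] -/
theorem norm_gtW_mul_I (β : ℝ) (U : Matrix.specialUnitaryGroup (Fin 2) ℂ) (y : ℝ) :
    ‖Complex.exp (2 * (β : ℂ) * ((u0 U : ℂ) * Complex.cos ((y : ℂ) * I) + (u3 U : ℂ) * Complex.sin ((y : ℂ) * I) - 1))‖ =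
      Real.exp (2 * β * (u0 U * Real.cosh y - 1)) := by
  rw [Complex.norm_exp, Complex.cos_mul_I, Complex.sin_mul_I]
  congr 1
  simp [Complex.cosh_ofReal_re, Complex.sinh_ofReal_re, Complex.cosh_ofReal_im, Complex.sinh_ofReal_im,
    Complex.mul_re, Complex.mul_im]

/-- **`|η(u, iy)| ≤ ½[(1 − u₀) + (cosh y − 1)]`**: `4|η|² = (1 − u₀ cosh y)² + u₃² sinh² y ≤ (1 − u₀ cosh y)² +
(1 − u₀²) sinh² y = (cosh y − u₀)²` (`u₀² + u₃² ≤ 1`, `cosh² − sinh² = 1`). [cite: MullerSchiemann1987, (2.13) p.264,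
(2.18) p.265] -/
theorem norm_etaOf_mul_I_le (U : Matrix.specialUnitaryGroup (Fin 2) ℂ) (y : ℝ) :
    ‖etaOf U ((y : ℂ) * I)‖ ≤ ((1 - u0 U) + (Real.cosh y - 1)) / 2 := by
  have hu := u0_sq_add_u3_sq_le_one U
  have hu0 := abs_le.mp (abs_u0_le_one U)
  have hch : 1 ≤ Real.cosh y := Real.one_le_cosh y
  have hcs : Real.cosh y ^ 2 = Real.sinh y ^ 2 + 1 := Real.cosh_sq y
  have hnn : 0 ≤ ((1 - u0 U) + (Real.cosh y - 1)) / 2 := by linarith [hu0.2]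
  have hsq : ‖etaOf U ((y : ℂ) * I)‖ ^ 2 ≤ (((1 - u0 U) + (Real.cosh y - 1)) / 2) ^ 2 := by
    rw [← Complex.normSq_eq_norm_sq, Complex.normSq_apply, etaOf_mul_I_re, etaOf_mul_I_im]
    have h3 : u3 U ^ 2 * Real.sinh y ^ 2 ≤ (1 - u0 U ^ 2) * Real.sinh y ^ 2 :=
      mul_le_mul_of_nonneg_right (by linarith) (sq_nonneg _)
    nlinarith [h3, hcs]
  exact (pow_le_pow_iff_left₀ (norm_nonneg _) hnn two_ne_zero).mp hsq

/-- **`|θ²(u, iy)| ≤ 2s(1 + s)`**, `s := (1 − u₀) + (cosh y − 1) ≤ 1`: from `|θ² − 4η| ≤ 8|η|²` (the sibling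
`MS87CentralAngleExpansion`) and `|η| ≤ s/2`. [cite: MullerSchiemann1987, (2.13) p.264, (2.18) p.265] -/
theorem norm_thetaSq_mul_I_le (U : Matrix.specialUnitaryGroup (Fin 2) ℂ) {y : ℝ}
    (hs : (1 - u0 U) + (Real.cosh y - 1) ≤ 1) :
    ‖thetaSq U ((y : ℂ) * I)‖ ≤
      2 * ((1 - u0 U) + (Real.cosh y - 1)) * (1 + ((1 - u0 U) + (Real.cosh y - 1))) := by
  have hu0 := abs_le.mp (abs_u0_le_one U)
  have hch : 1 ≤ Real.cosh y := Real.one_le_cosh y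
  have hs0 : 0 ≤ (1 - u0 U) + (Real.cosh y - 1) := by linarith [hu0.2]
  have hη : ‖etaOf U ((y : ℂ) * I)‖ ≤ ((1 - u0 U) + (Real.cosh y - 1)) / 2 := norm_etaOf_mul_I_le U y
  have hη' : ‖etaOf U ((y : ℂ) * I)‖ ≤ 1 / 2 := by linarith
  have h1 := norm_thetaSq_sub_le U hη'
  have h2 : ‖(4 : ℂ) * etaOf U ((y : ℂ) * I)‖ = 4 * ‖etaOf U ((y : ℂ) * I)‖ := by
    rw [norm_mul, Complex.norm_ofNat]
  have h3 := norm_le_insert' (thetaSq U ((y : ℂ) * I)) ((4 : ℂ) * etaOf U ((y : ℂ) * I))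
  rw [h2] at h3
  nlinarith [norm_nonneg (etaOf U ((y : ℂ) * I))]

/-- `cosh t − 1 ≤ t²` for `|t| ≤ 1`. [folklore] -/
private theorem cosh_sub_one_le_sq {t : ℝ} (ht : |t| ≤ 1) : Real.cosh t - 1 ≤ t ^ 2 := by
  have h1 := Real.abs_exp_sub_one_sub_id_le ht
  have h2 := Real.abs_exp_sub_one_sub_id_le (show |-t| ≤ 1 by rwa [abs_neg])
  rw [Real.cosh_eq]
  have := (abs_le.mp h1).2; have := (abs_le.mp h2).2
  nlinarith

/-- `|cosh t − 1 − t²/2| ≤ (5/96)t⁴` for `|t| ≤ 1` (Mathlib's `Real.exp_bound` at order 4). [folklore] -/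
private theorem abs_cosh_taylor_le {t : ℝ} (ht : |t| ≤ 1) : |Real.cosh t - 1 - t ^ 2 / 2| ≤ 5 / 96 * t ^ 4 := by
  have h1 := Real.exp_bound ht (show 0 < 4 by norm_num)
  have h2 := Real.exp_bound (show |-t| ≤ 1 by rwa [abs_neg]) (show 0 < 4 by norm_num)
  have hs : ∀ x : ℝ, ∑ m ∈ Finset.range 4, x ^ m / m.factorial = 1 + x + x ^ 2 / 2 + x ^ 3 / 6 := by
    intro x
    simp only [Finset.sum_range_succ, Finset.sum_range_zero, Nat.factorial]
    norm_num
  rw [hs] at h1 h2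
  have hn : ((4:ℕ).succ : ℝ) / ((4:ℕ).factorial * (4:ℕ)) = 5 / 96 := by norm_num [Nat.factorial]
  rw [hn] at h1 h2
  rw [abs_neg] at h2
  have e : Real.cosh t - 1 - t ^ 2 / 2 =
      ((Real.exp t - (1 + t + t ^ 2 / 2 + t ^ 3 / 6)) + (Real.exp (-t) - (1 + -t + (-t) ^ 2 / 2 + (-t) ^ 3 / 6))) / 2 := by
    rw [Real.cosh_eq]; ring
  rw [e, abs_div, abs_two]
  have := abs_add_le (Real.exp t - (1 + t + t ^ 2 / 2 + t ^ 3 / 6))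
    (Real.exp (-t) - (1 + -t + (-t) ^ 2 / 2 + (-t) ^ 3 / 6))
  have h4 : |t| ^ 4 = t ^ 4 := by rw [← abs_pow, abs_of_nonneg (by positivity)]
  rw [h4] at h1 h2
  linarith

/-- **The β-free core of (A₂) for (W)**: for `1 < κ`, `0 ≤ p < 1 − κ²/4`, `0 < ϱ ≤ min(½, (1 − κ²/4 − p)/3)`,
`|y| < (κ/2)ϱ` and `u ∉ 𝒢[iy, ϱ]`: `2(u₀ cosh y − 1) < y² − pϱ²`. Cases: `u₀ ≤ 0` (then the left side is `≤ 2(cosh y −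
2)`); `1 − u₀ ≥ δ/2`, `δ := 1 − κ²/4 − p` (then `−2(1 − u₀)` wins); `1 − u₀ < δ/2` and `|θ²(u, iy)| ≥ ϱ²` (then
`|θ²| ≤ 2s(1 + s)`, `s = (1 − u₀) + (cosh y − 1)`, forces `2(1 − u₀) ≥ ϱ²(1 − s) − 2(cosh y − 1)`, and `p < 1 − κ²/4` is
exactly the room for `y² < (κ²/4)ϱ²`). [cite: MullerSchiemann1987, (A₂) p.267, p.268 L.30–31, (2.18) p.265] -/
theorem A2_core {κ p ϱ y : ℝ} {U : Matrix.specialUnitaryGroup (Fin 2) ℂ} (hκ : 1 < κ) (hp : 0 ≤ p)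
    (hδ : p < 1 - κ ^ 2 / 4) (hϱ : 0 < ϱ) (hϱ1 : ϱ ≤ 1 / 2) (hϱ2 : ϱ ≤ (1 - κ ^ 2 / 4 - p) / 3)
    (hy : |y| < κ / 2 * ϱ) (hu : U ∉ regionG ((y : ℂ) * I) ϱ) :
    2 * (u0 U * Real.cosh y - 1) < y ^ 2 - p * ϱ ^ 2 := by
  -- the constants
  have hδ0 : 0 < 1 - κ ^ 2 / 4 - p := by linarith
  have hκ0 : 0 < κ := by linarith
  have hκ2 : κ < 2 := by nlinarith
  have hp1 : p < 1 := by nlinarith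
  have hy1 : |y| < ϱ := by
    have : κ / 2 * ϱ < 1 * ϱ := mul_lt_mul_of_pos_right (by linarith) hϱ
    linarith
  have hyabs : |y| ≤ 1 := by linarith
  have hy2 : y ^ 2 < κ ^ 2 / 4 * ϱ ^ 2 := by
    have h0 : 0 ≤ κ / 2 * ϱ := by positivity
    have h := mul_self_lt_mul_self (abs_nonneg y) hy
    rw [abs_mul_abs_self] at h
    nlinarith
  have hyϱ : y ^ 2 < ϱ ^ 2 := by
    have h := mul_self_lt_mul_self (abs_nonneg y) hy1
    rw [abs_mul_abs_self] at h
    nlinarith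
  have hϱsq : ϱ ^ 2 ≤ 1 / 4 := by nlinarith
  have hy4 : y ^ 4 ≤ ϱ ^ 2 * ϱ ^ 2 := by
    have e : y ^ 4 = y ^ 2 * y ^ 2 := by ring
    rw [e]
    exact mul_le_mul hyϱ.le hyϱ.le (sq_nonneg _) (sq_nonneg _)
  have hϱ4 : ϱ ^ 2 * ϱ ^ 2 ≤ ϱ ^ 2 / 4 := by nlinarith [sq_nonneg ϱ]
  have hϱδ : ϱ ^ 2 ≤ (1 - κ ^ 2 / 4 - p) / 6 := by nlinarith
  have hpϱ : p * ϱ ^ 2 ≤ ϱ ^ 2 := by nlinarith [sq_nonneg ϱ]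
  -- `d = cosh y − 1`, `s = 1 − u₀`
  have hd0 : 0 ≤ Real.cosh y - 1 := by linarith [Real.one_le_cosh y]
  have hd1 : Real.cosh y - 1 ≤ y ^ 2 := cosh_sub_one_le_sq hyabs
  have hd3 : Real.cosh y - 1 ≤ y ^ 2 / 2 + 5 / 96 * y ^ 4 := by
    have := (abs_le.mp (abs_cosh_taylor_le hyabs)).2; linarith
  have hu0 := abs_le.mp (abs_u0_le_one U)
  have hs0 : 0 ≤ 1 - u0 U := by linarith [hu0.2]
  have hsd : 0 ≤ (1 - u0 U) * (Real.cosh y - 1) := mul_nonneg hs0 hd0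
  have key : 2 * (u0 U * Real.cosh y - 1) =
      2 * (Real.cosh y - 1) - 2 * (1 - u0 U) - 2 * ((1 - u0 U) * (Real.cosh y - 1)) := by ring
  rw [key]
  -- the region condition
  rw [mem_regionG, not_and_or, not_lt, not_lt] at hu
  rcases hu with hu0' | hθ
  · -- `u₀ ≤ 0`
    have hs1 : 1 ≤ 1 - u0 U := by linarith
    linarith
  · by_cases hfar : (1 - κ ^ 2 / 4 - p) / 2 ≤ 1 - u0 U
    · -- `u` far from `e₀`: `−2(1 − u₀) ≤ −δ` wins
      linarith
    · -- `u` near `e₀`: use `ϱ² ≤ |θ²(u, iy)| ≤ 2s(1 + s)`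
      push Not at hfar
      have hκsq : 1 < κ ^ 2 := by nlinarith
      have hϱϱ : ϱ ^ 2 ≤ ϱ / 2 := by nlinarith
      have hs1 : (1 - u0 U) + (Real.cosh y - 1) ≤ 1 := by linarith
      have hθle := norm_thetaSq_mul_I_le U hs1
      have h1 : ϱ ^ 2 ≤ 2 * ((1 - u0 U) + (Real.cosh y - 1)) * (1 + ((1 - u0 U) + (Real.cosh y - 1))) :=
        hθ.trans hθle
      have hσ0 : 0 ≤ (1 - u0 U) + (Real.cosh y - 1) := by linarith
      -- `ϱ²(1 − s) ≤ 2s(1 + s)(1 − s) = 2s(1 − s²) ≤ 2s`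
      have h2 : ϱ ^ 2 * (1 - ((1 - u0 U) + (Real.cosh y - 1))) ≤ 2 * ((1 - u0 U) + (Real.cosh y - 1)) := by
        have h1' := mul_le_mul_of_nonneg_right h1 (show 0 ≤ 1 - ((1 - u0 U) + (Real.cosh y - 1)) by linarith)
        nlinarith [h1', hσ0, mul_nonneg hσ0 (mul_nonneg hσ0 hσ0)]
      -- `δ − s ≥ 2ϱ²` (from `3ϱ ≤ δ`, `ϱ ≤ ½`, `s < δ/2 + ϱ²`)
      have hδσ : 2 * ϱ ^ 2 ≤ (1 - κ ^ 2 / 4 - p) - ((1 - u0 U) + (Real.cosh y - 1)) := by linarith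
      have H4 : ϱ ^ 2 * (2 * ϱ ^ 2) ≤ ϱ ^ 2 * ((1 - κ ^ 2 / 4 - p) - ((1 - u0 U) + (Real.cosh y - 1))) :=
        mul_le_mul_of_nonneg_left hδσ (sq_nonneg ϱ)
      have hr4 : 0 ≤ ϱ ^ 2 * ϱ ^ 2 := by positivity
      linarith [h2, H4, hd3, hy4, hy2, hsd, hr4]

/-- **(A₂) FOR THE WILSON ACTION with an explicit domain parameter `ϱ`**: for `1 < κ`, `0 ≤ p < 1 − κ²/4`, every
`β > 0`, `0 < ϱ ≤ ϱ₀ := min(½, (1 − κ²/4 − p)/3)`, `|y| < (κ/2)ϱ` and `u ∉ 𝒢[iy, ϱ]`: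
`|g̃_W(u, iy)| < exp{βy² − pβϱ²}`. [cite: MullerSchiemann1987, (A₂) p.267, p.268 L.30–31] -/
theorem A2_wilson_rho {κ p : ℝ} (hκ : 1 < κ) (hp : 0 ≤ p) (hδ : p < 1 - κ ^ 2 / 4) {β ϱ : ℝ} (hβ : 0 < β)
    (hϱ : 0 < ϱ) (hϱ0 : ϱ ≤ min (1 / 2) ((1 - κ ^ 2 / 4 - p) / 3)) {y : ℝ} (hy : |y| < κ / 2 * ϱ)
    {U : Matrix.specialUnitaryGroup (Fin 2) ℂ} (hu : U ∉ regionG ((y : ℂ) * I) ϱ) :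
    ‖Complex.exp (2 * (β : ℂ) * ((u0 U : ℂ) * Complex.cos ((y : ℂ) * I) + (u3 U : ℂ) * Complex.sin ((y : ℂ) * I) - 1))‖ <
      Real.exp (β * y ^ 2 - p * β * ϱ ^ 2) := by
  rw [norm_gtW_mul_I, Real.exp_lt_exp]
  have h := A2_core hκ hp hδ hϱ (hϱ0.trans (min_le_left _ _)) (hϱ0.trans (min_le_right _ _)) hy hu
  have := mul_lt_mul_of_pos_left h hβ
  linarith

/-- **(A₂) FOR THE WILSON ACTION, AS PRINTED** (`ϱ = β^{−α}`): for `1 < κ`, `0 ≤ p < 1 − κ²/4` and every `β > 0` in the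
weak coupling region `β^{−α} ≤ ϱ₀` («β ≥ β̲»): *«For y ∈ ℝ, |y| < (κ/2)β^{−α} and u ∈ G∖𝒢[iy, β^{−α}],
|g̃(u, iy)| < exp{βy² − pβ^{1−2α}}»* for `g̃ = g̃_W`. [cite: MullerSchiemann1987, (A₂) p.267, p.268 L.30–31] -/
theorem A2_wilson {κ p α β : ℝ} (hκ : 1 < κ) (hp : 0 ≤ p) (hδ : p < 1 - κ ^ 2 / 4) (hβ : 0 < β)
    (hβα : β ^ (-α) ≤ min (1 / 2) ((1 - κ ^ 2 / 4 - p) / 3)) :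
    ∀ y : ℝ, |y| < κ / 2 * β ^ (-α) → ∀ u : Matrix.specialUnitaryGroup (Fin 2) ℂ,
      u ∉ regionG ((y : ℂ) * I) (β ^ (-α)) →
      ‖Complex.exp (2 * (β : ℂ) * ((u0 u : ℂ) * Complex.cos ((y : ℂ) * I) + (u3 u : ℂ) * Complex.sin ((y : ℂ) * I) - 1))‖ <
        Real.exp (β * y ^ 2 - p * β ^ (1 - 2 * α)) := by
  intro y hy u hu
  have hϱ : 0 < β ^ (-α) := Real.rpow_pos_of_pos hβ _
  have h := A2_wilson_rho hκ hp hδ hβ hϱ hβα hy hu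
  have e : p * β * (β ^ (-α)) ^ 2 = p * β ^ (1 - 2 * α) := by
    rw [show (1 - 2 * α) = 1 + (-α + -α) by ring, Real.rpow_add hβ, Real.rpow_add hβ, Real.rpow_one]
    ring
  rwa [e] at h

/-! ## §5 Theorem 2 part 3) for the Wilson action at the initial scale -/

/-- **THEOREM 2 PART 3) FOR THE WILSON ACTION AT THE INITIAL SCALE**: the sibling's model-free `thm2_part3` (its
hypotheses (2.8) and (A₂) DISCHARGED by `gtW_diagPhase_mul` and `A2_wilson`): for `1 < κ`, `0 ≤ p < 1 − κ²/4`,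
`β > 0` with `β^{−α} ≤ ϱ₀`, and `z = x + iy` with `β^{−α} ≤ |z| < 1`, `|y| < (κ/2)β^{−α}`:
`|h_W(z)| = |exp{2β(cos z − 1)}| < exp{βy² − pβ^{1−2α}}`. [cite: MullerSchiemann1987, Thm 2 part 3) p.281, (6.15)
p.281, (A₂) p.267] -/
theorem thm2_part3_wilson {κ p α β : ℝ} (hκ : 1 < κ) (hp : 0 ≤ p) (hδ : p < 1 - κ ^ 2 / 4) (hβ : 0 < β)
    (hβα : β ^ (-α) ≤ min (1 / 2) ((1 - κ ^ 2 / 4 - p) / 3)) {x y : ℝ}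
    (hz1 : β ^ (-α) ≤ ‖(x : ℂ) + y * I‖) (hz2 : ‖(x : ℂ) + y * I‖ < 1) (hy : |y| < κ / 2 * β ^ (-α)) :
    ‖Complex.exp (2 * (β : ℂ) * (Complex.cos ((x : ℂ) + y * I) - 1))‖ < Real.exp (β * y ^ 2 - p * β ^ (1 - 2 * α)) := by
  have h := thm2_part3 (gt := fun (U : Matrix.specialUnitaryGroup (Fin 2) ℂ) (z : ℂ) =>
      Complex.exp (2 * (β : ℂ) * ((u0 U : ℂ) * Complex.cos z + (u3 U : ℂ) * Complex.sin z - 1)))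
    (fun x' U z => gtW_diagPhase_mul β x' U z) hβ (A2_wilson hκ hp hδ hβ hβα) hz1 hz2 hy
  have e := gtW_one β ((x : ℂ) + y * I)
  rwa [e] at h

end WilsonAction

end MullerSchiemann1987

end Literature.MathematicalPhysics.QuantumFieldTheory
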